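import Summits.Ventures.PercRepro.CodeBoundKernel
import Summits.Ventures.PercRepro.C005Seven

/-!
# C-005 for marked multigraphs with at most eight edges, unconditionally

`CodeBoundKernel.lean` proves the 8-point code bound (`codeBound8_holds`); `C005Seven.lean`
derives C-005 on ≤ 8 edges from that bound (`C005_of_card_le_eight`). This file just composes the
two, so that the unconditional statement has a name of its own.
-/

namespace PercRepro

/-- **C-005 for every marked multigraph with at most eight edges**, unconditionally. -/
theorem C005_of_card_le_eight' {V E : Type} [Fintype E] [DecidableEq E]
    (G : MultiGraph V E) (hE : Fintype.card E ≤ 8) (p : E → ℝ) (hp : IsProb p) (a b c d : V) :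
    prob p (G.partitionEvent ![a, b, c, d] ![0, 0, 1, 1]) *
        prob p (G.partitionEvent ![a, b, c, d] ![0, 1, 0, 1]) +
      prob p (G.partitionEvent ![a, b, c, d] ![0, 0, 1, 1]) *
        prob p (G.partitionEvent ![a, b, c, d] ![0, 1, 1, 0]) +
      prob p (G.partitionEvent ![a, b, c, d] ![0, 1, 0, 1]) *
        prob p (G.partitionEvent ![a, b, c, d] ![0, 1, 1, 0]) ≤
    prob p (G.partitionEvent ![a, b, c, d] ![0, 0, 0, 0]) *
      prob p (G.partitionEvent ![a, b, c, d] ![0, 1, 2, 3]) :=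
  C005_of_card_le_eight codeBound8_holds G hE p hp a b c d

end PercRepro
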